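import Mathlib
import Literature.Computability.AlgebraicComplexity.ValiantClasses
import HarnessLib

/-!
# Dutta 2021, Theorem 2: a linear real-zero bound for sparse weighted sums of squares separates
# `VP` from `VNP` over `ℂ`

Topic `Literature/Computability/AlgebraicComplexity` (next to `NewtonPolygonTau.lean`, whose
`KPTT.theorem1` — a printed transfer theorem recorded as a NAMED FACT with its unproved hypothesis
INLINED as the antecedent — is the pattern followed here). Filed by a grounder for route
`ValiantsHypothesis/SOSTau`, crux `HutchinsonMagnification` (stmt-ValiantsHypothesis-18749); the
antecedent below is the body of that route's crux `SOSTau` (stmt-ValiantsHypothesis-18748) verbatim,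
which the route sets out to prove (it is registered there, under `Summits/`, as the gate requires for
unproved hypotheses; nothing unproved is asserted in this file).

**Printed statements (read verbatim, held text `paper:arxiv-2406.06217`, p. 20).** P. Bürgisser,
*Completeness classes in algebraic complexity theory* (2024), §4.6: "Recently, Dutta [dutta:21]
proposed a version of the real τ-[hypothesis 4.1] for linear combinations of squares of univariate
polynomials `F ∈ ℝ[x]`. Consider representations `F = c₁f₁² + … + c_s f_s²`, where `cᵢ ∈ ℝ` and
`fᵢ ∈ ℝ[x]` has `tᵢ` monomials. The support-sum size `SoS_ℝ(F)` is defined as minimum of the sum of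
sparsities `t₁ + … + t_s` over all such representations of `F`. … **4.2 (SoS τ-[hypothesis]).**
There is `c > 0` such that for all nonzero `F ∈ ℝ[x]`, the number of real zeros of `F` is at most
`c · SoS_ℝ(F)`." — followed by: "Remarkably, as shown in [dutta:21], this [4.2] not only implies the
separation `VP ≠ VNP` over `ℂ`, but also implies the existence of explicit families of rigid
matrices." The original is P. Dutta, CSR 2021, LNCS 12730, doi:10.1007/978-3-030-79416-3_5, whose
Theorem 2 (§3.2) is this implication, proved by magnifying the linear sparse-SOS hardness of the
explicit all-real-rooted family `f_d = Σ_{i ≤ d} 2^{2i(d−i)} xⁱ` (`d` distinct real zeros) through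
the Dutta–Saxena–Thierauf SOS decomposition (tree: `DuttaSaxenaThierauf2024_sosDecomposition`,
PROVED in `SOSDecomposition.lean`). The LNCS text is not held at filing time (acquisition request
acq-06628; the route's refuter review page-checked Thm. 2 on the publisher's pages), so the
statement is rendered from Bürgisser's verbatim restatement and cites both.

**Rendering.** "number of real zeros" = number of DISTINCT real zeros (`roots.toFinset.card`; with
multiplicity 4.2 fails already for `x^{2m} = (x^m)²`). The minimum `SoS_ℝ(F)` is avoided by
quantifying over representations: "`∃ c, ∀ s a g, #zeros(Σ aᵢgᵢ²) ≤ c · Σ |supp gᵢ|`" is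
equivalent to 4.2 (apply 4.2 to a minimising representation; conversely bound by any representation;
the zero polynomial has `roots = 0` in Mathlib, so "nonzero" may be dropped; `c : ℕ` is the ceiling
of the printed real `c > 0`). `VP ≠ VNP` over `ℂ` is `VP ℂ ≠ VNP ℂ` (`ValiantClasses.lean`,
Bürgisser's standard classes) — the summit statement `ValiantsHypothesis` unfolded.

## Tree search

`lean search 'SOSTau|sosTau|Dutta2021'`: no declaration outside the route file. Related, different:
`CplxAlg.KoiranRealTauConjecture` with `Literature/Barriers/ValiantsHypothesis/TauRealZeros.lean`
(sums of PRODUCTS of sparse polynomials), `KPTT.theorem1` (Newton polygons ⇒ permanent ∉ VP), and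
the proved SOS decomposition fact above.

## References

* [Burgisser2024Completeness] P. Bürgisser, *Completeness classes in algebraic complexity theory*,
  arXiv:2406.06217 (2024), §4.6: statement 4.2 and the sentence following it (held text p. 20).
* [Dutta2021] P. Dutta, *Real τ-conjecture for sum-of-squares: a unified approach to lower bound and
  derandomization*, CSR 2021, LNCS 12730 (2021), doi:10.1007/978-3-030-79416-3_5: Theorem 2 (§3.2).
-/

noncomputable section

open Polynomial

namespace Literature.Computability.AlgebraicComplexity

/-- NAMED FACT — **Dutta 2021, Theorem 2** (restated in Bürgisser 2024, §4.6, after statement 4.2: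
"as shown in [dutta:21], this … implies the separation `VP ≠ VNP` over `ℂ`"): IF an absolute
constant `c` bounds the number of distinct real zeros of every real weighted sum of squares
`Σ_{i<s} aᵢ gᵢ²` (`aᵢ ∈ ℝ`, `gᵢ ∈ ℝ[x]`) by `c · Σ_{i<s} |supp gᵢ|` — Dutta's SoS τ-hypothesis,
Bürgisser's 4.2 in representation form, the antecedent (NOT asserted here; it is the crux `SOSTau`
of route `ValiantsHypothesis/SOSTau`) — THEN `VP ℂ ≠ VNP ℂ`. A theorem in print, not proved in the
tree (D-0014); users take `(h : Dutta2021_theorem2)`. Grounds the crux `HutchinsonMagnification` of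
that route, whose hypothesis (linear SOS-hardness of `tavenasV n = f_{2ⁿ−1}` over real
representations) is what the printed proof extracts from the antecedent.
[cite: Dutta2021, Theorem 2] [cite: Burgisser2024Completeness, §4.6 (4.2 and the sentence after it)] -/
def Dutta2021_theorem2 : Prop :=
  (∃ c : ℕ, ∀ (s : ℕ) (a : Fin s → ℝ) (g : Fin s → Polynomial ℝ),
      (∑ i, Polynomial.C (a i) * g i ^ 2).roots.toFinset.card ≤ c * ∑ i, (g i).support.card) →
    VP ℂ ≠ VNP ℂ

end Literature.Computability.AlgebraicComplexity

end
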